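import Mathlib
import HarnessLib
import HarnessLib.Audit
import Summits.FinalStateConjecture.Statement
import HarnessLib.Audit.Status.Attr

/-!
Route: StarvedNecks

DORMANT since 2026-08-25T09:58:45Z (reconciler: no traction for 7.6 d (last activity item-evidence-added at 2026-08-17T19:10:44Z); parked, not closed — `ledger route dormant route-FinalStateConjecture-StarvedNecks --off` to reactivate) — unstaffed, not closed; items shared with open routes are served there. `ledger route dormant <id> --off` reactivates.

# Route StarvedNecks — between a black hole and its radiation lies only Minkowski space —
fixed-radius settling plus starved, seamed necks decide the exhaustiveness clause

X = G ∧ S ∧ E ∧ F ("it suffices to show"), S cut into its physics S₁ = NeckGapDecay and its gauge S₂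
= GapDecaySuffices (S₁ → S), and the
deciding theorem `closes : G → S₁ → S₂ → E → F → FinalStateConjecture` is PROVED (pure logic, std
axioms, authority native, rev 6). The route factors the summit at the ONE clause no
convergence-on-compact-sets theorem
delivers — `HasExhaustiveCharts` (certified charts out to GROWING radii Rᵢ(τ) → ∞) — into a
compactness-grade generic import
and three deterministic theorems about one annulus per hole:
G (HonestFixedRadiusSettlingT, crux r3, the only generic item): TAME-Christodoulou-generic
admissible data have an MGHD with
complete 𝓘⁺ carrying an honest C⁴ N-hole `FinalStateDecomposition` of O = J⁺(ιX) ∩ I⁻(charts) —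
near-zone convergence to ONE
sub-extremal boosted Kerr per hole at every FIXED radius, a flat radiation zone outside sublinear
tubes, rays in closure O,
HonestCore ∧ HonestFar bookkeeping (R₀ ≥ 100Mᵢ, orthochronous labels, anchoring, closedness, Voronoi
C⁰ honesty), pairwise
distinct hole velocities; NOTHING is asked between a fixed radius and the flat tubes. WHY THIS FORM
IS EASIER than the
summit: fixed-radius C^k convergence is the OUTPUT FORMAT of every capture theorem in print (DHRT
arXiv:2104.08222, KS/GKS
arXiv:2205.14808: convergence on {r ≤ R} for each fixed R, to high finite order) and of
ω-limit/compactness arguments — regularity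
(C⁴ vs the summit's C²) costs nothing there, radius-UNIFORMITY is the content, and that is removed
from G; G is shared in
substance with every capture route of the sub-problem, all of which assume MORE (growing radii
inside their capture crux).
S (NecksCertifyR, r2; CUT in rev 5/6 into its physics and its gauge, filed as two top-level cruxes
because the gate reserves a formal `--split` to final seats — `closes` takes both and NecksCertifyR
:= GapDecaySuffices NeckGapDecay inside the proof): every honest fixed-radius decomposition re-seams
into a C² HonestCore ∧ SEAMED decomposition of the SAME O certified out to growing radii. S ⇐
NeckGapDecay ∧ GapDecaySuffices:
· NeckGapDecay (crux r2, THE DECIDING PHYSICS): on the gap annulus {Rg(τ) < rᵢ ≤ ρᵢ(τ)} between the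
fixed-radius-certified
near zone and the flat-certified radiation zone — where the input gives only C⁰ control — two
derivatives of the vacuum metric
decay: a hole-anchored chart (= Ψᵢ inside R₁+1) is C²-certified out to a wall W ≥ 3ρᵢ+2 (physical
overlap ≳ ρᵢ with the flat chart's certified image, drift-proof). THE LEVER (mechanism grade):
HUYGENS
AT RADIUS ρ — cut off at the certified collar, a gap point is fed only by the certified cylinder
(Duhamel at retarded time
t − 5ρ → ∞) and by its backward cone shell at radii [4ρ, 5ρ], which lies ENTIRELY in the
flat-certified zone; Kirchhoff at
radius σ ∈ [4ρ,5ρ] converts the focusing gain λρ into ONE sphere-averaged derivative, bounded by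
√(ρ⁻¹ × cone-shell L²
ledger) (Cauchy–Schwarz + pigeonhole in σ); the CONE LEDGER per unit wall radius → 0 is starvation
in integrated,
focusing-blind, provenance-blind, rate-free form. Its LINEAR MODEL IS KERNEL-CHECKED (Kirchhoff
p87050, Huygens neck lemma
p104311/p111535, strong Huygens p112122, dispersive decay p113590); the nonlinear step is the
Klainerman–Rodnianski covariant
Kirchhoff–Sobolev parametrix for □_g Riem = Riem⋆Riem under L²-curvature-flux control
(KlainermanRodnianski2007; breakdown
criterion KlainermanRodnianski2010Breakdown; KRS arXiv:1204.1767) with the far ledger by CK/KN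
transport, and the Huygens
localisation of the intermediate zone is the printed move of Luk–Oh arXiv:2404.02220 §1.2.4. WHY
EASIER: deterministic (no
genericity), one scale-free annulus at r ≥ 100Mᵢ (no trapping, ergoregion, horizon, redshift; Kerr
tail ≤ 1/50 in C²), every
smallness input typed and rate-free, and the problem TYPE — pointwise bounds from L² flux + Huygens
localisation — has a track
record (KR breakdown criterion; YMH large-data decay arXiv:1902.08519; Luk–Oh tails).
· GapDecaySuffices (crux r6): NeckGapDecay → NecksCertifyR — gauge geometry, no PDE, provable now
(XL): belt-trick unwinding,
log-radial and [ρₐ,4ρₐ] blending, Lorentzian transition rigidity (Riemannian half landed: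
ADMTransitionRigidity/Rotation), then
the LANDED reduction necksCertifyR_of_neckLedgerAnalysisPos (p131681; seam N2 p94437 + 16 layers,
chart surgery p107332, cone
separation p106992, N = 0 case PROVED p116183/p116546) — composition kernel-checked (Sketch.lean
gapDecaySuffices_of_posSoft).
E (SeamedChartsExhaust, PROVED p128314): HonestCore ∧ SEAMED ∧ O = exteriorOf ⇒ HasExhaustiveCharts.
F (FutureOrientedOfSeamed,
crux r5, deterministic L-sized bookkeeping): the same ⇒ IsFutureOriented (orientation constant on
connected slabs, anchored by
SEAMED (5)). History: rev 2/3 (2026-08-16) repaired S misstated without distinct velocities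
(¬NecksCertify ⇔ ComovingPairWitness,
p121147/p123270) and re-typed G for the revised summit (p126844); rev 5/6 (promote-to-A) file the
two cruxes, the lever and the rewired `closes`.
Lean: `HonestFixedRadiusSettlingT ∧ NeckGapDecay ∧ GapDecaySuffices ∧ SeamedChartsExhaust ∧
FutureOrientedOfSeamed`

## Assembly
Pure logic, proved sorry-free (`closes`, axioms propext · Classical.choice · Quot.sound): TAME
Christodoulou genericity
`IsTameChristodoulouGeneric 𝓓 P 1` is antitone in the exceptional set, so it suffices that G's
property implies the Statement's
property pointwise on 𝓓: given the MGHD clause and, for every MGHD 𝒟, complete 𝓘⁺ and (O, d, R₀)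
with RaysStayInClosure 𝒟 O,
HonestCore ∧ HonestFar and distinct velocities, S yields (d₂, R, R₀') with HonestCore ∧ SEAMED and O
= exteriorOf 𝒟 d₂.charted,
E yields HasExhaustiveCharts d₂, F yields IsFutureOriented d₂, sub-extremality of d₂ is the first
conjunct of HonestCore and the
rays clause is G's (same O) — verbatim the Statement's conjunct with witness (O, d₂). Below S (rev
6): `closes` takes h₂ : NeckGapDecay and h₃ : GapDecaySuffices and uses NecksCertifyR := h₃ h₂ (no
glue item needed;
GapDecaySuffices = PosSoft ∘ landed p131681, kernel-checked in Sketch.lean). The rev-1 items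
HonestFixedRadiusSettling (implies nothing load-bearing; implied by G) and NecksCertify (implies S;
false modulo ComovingPairWitness) and the rev-1 Assembly decl stay in the file as superseded support
edges because landed
Theorems / Negative lemmas name them; `closes` is the deciding theorem.

Rationale: WHY THIS LINE. The neck of hole i at late time — the annulus between a fixed certified near-zone
radius and the flat chart's tube wall ρᵢ(τ) → ∞ — is the
only place where fixed-radius (ω-limit / compactness) settling falls short of the typed Statement:
G's flat chart is certified wherever it is
defined, G's hole chart is certified out to the diagonal radius Rg(τ) of its fixed-radius rates
(support DiagonalRadii, PROVED), and nothing
relates the two growth rates, so an uncertified GAP ANNULUS {Rg(τ) < rᵢ ≤ ρᵢ(τ)} survives exactly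
there, with only C⁰ control (Hf(3)). Rev 5/6
(promote-to-A, 2026-08-16/17) isolate that annulus as its own typed crux NeckGapDecay (the lead
census' PosGap) and records THE LEVER, mechanism
grade, that five line leads and three triage panels distilled (Cruxes/NecksCertify: line
two-cap-focusing-ledger v5, TRIAGE r1-1/2/3, AUDIT-c4):
HUYGENS AT RADIUS ρ. Cut off at the certified collar {R₀ ≤ r ≤ R₀+1}: by the sharp Huygens principle
a gap point p = (t, x), |x| ≤ ρ(t), is
fed only by (a) the certified cylinder — the Duhamel integral of the cutoff source, of size the C³
cylinder certificate at retarded times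
≥ t − 5ρ(t) → ∞, no rate needed — and (b) its backward null cone truncated to radii σ ∈ [4ρ, 5ρ],
which lies ENTIRELY in the flat-certified
zone (ρ monotone sublinear). Kirchhoff's representation at radius σ gives |∂ᵏψ(p)| ≤ sup_{far
sphere}|∂ᵏψ| + σ⨍|∂^{k+1}ψ| + Duhamel; the middle
term IS the focusing story (σ·∂ ≈ ρλ at frequency λ) and by Cauchy–Schwarz on the sphere plus a
pigeonhole in σ it is ≤ √(ρ⁻¹ ∫_{cone shell}
|∂^{k+1}ψ|²): the CONE LEDGER (orders 1–3, per unit wall radius) — in diffraction terms the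
geometric mean of a weight-two provenance cap and the
unweighted C⁴ certificate, the two caps that no single admissible packet can satisfy at once (focal
curvature ~1 needs λ ≥ ρ/𝔅 and λ ≤ ερ,
i.e. ε𝔅 ≥ 1). The ledger is focusing-blind (L²), provenance-blind and frame-blind, and every class
meets it RATE-FREE: data-borne incoming
radiation by o₂ admissibility at radius ≈ t plus the flat C⁴ certificate (the W-test profiles G =
v^{−a} sin v^p pass at orders ≤ 3 because o₂
(a > 2p) and flat C⁴ (a > 4p−4−θ) force a > 3p−3; kit job j010237); the hole's own late emission
through the cylinder certificate; cross-hole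
content (ρ/dᵢⱼ)² with dᵢⱼ ≥ c·t from distinct velocities (cone separation, landed p106992); the Kerr
tail M²/ρ²; radiated energy by Bondi /
Hawking-mass monotonicity on far outgoing cones (positivity, tails of a convergent integral ≤
M_ADM). THE LINEAR MODEL IS KERNEL-CHECKED,
sorry-free: Kirchhoff–Duhamel on ℝ¹⁺³ (p87050, chain p91959 p86030 p88330 p88341), the Huygens neck
lemma M2 = exactly the statement above for
□_η outside a cylinder ([cyl] C³ → 0, [flat] C² → 0, [cone] ledger ≤ e·ρ ⟹ C² → 0 on the necks;
p104311, exported p111535), strong Huygens /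
domain of dependence (p112122), uniform t⁻¹ dispersive decay (p113590). The NONLINEAR step is the
same representation for □_g Riem = Riem⋆Riem:
the Klainerman–Rodnianski COVARIANT Kirchhoff–Sobolev parametrix, valid in Einstein vacuum exactly
when the past cone's radius of conjugacy /
injectivity is controlled, which KR derive from the L² curvature FLUX along the cone
(KlainermanRodnianski2007 pp. 4–5 and §2.4; breakdown
criterion KlainermanRodnianski2010Breakdown; L² curvature theorem KRS arXiv:1204.1767) — so the neck
geometry is held in L²-flux norms, where the
focusing enemy is invisible, and sup bounds cost the one derivative the ledger pays; the a-priori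
coordinate frame is Hf(3) (C⁰, 1/(10‖Λ‖²)),
the weak field is Hc(1) (r ≥ 100M: Kerr(T,T) ≤ −0.97, tail ≤ 1/50 in C², backscatter Duhamel
∫_{t/4}^∞ s|V| ds = O(M/t)); the far ledger is
CK/KN ∇₃-transport of the incoming Bianchi pairs from the o₂ datum to the collar with r⁻²-summable
couplings (ChristodoulouKlainerman1993 Ch. 7–8,
KlainermanNicolo2003; term-by-term check TRIAGE r1-2). PRINTED PRECEDENT for the Huygens
localisation of the intermediate zone: Luk–Oh
arXiv:2404.02220 §1.2.4 p. 13 ("we use the strong Huygens principle … the main term only has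
contribution from the wave zone … Minkowskian
computation … integration by characteristic when d = 3") and §8 p. 91, on dynamical backgrounds with
nonlinearities; for pointwise control from a
light-cone representation with nonlinear sources: Eardley–Moncrief L∞ estimates (YMH large-data
decay arXiv:1902.08519). Imported from
geometric analysis is only the bubble-tree ORGANISATION (neck ↦ intermediate zone, no neck energy ↦
starvation); the analysis is hyperbolic.
What the line adds to the routes of this sub-problem: TangentConeAtIPlus, RaychaudhuriBlowdown,
ResolvedTimelikeInfinity, TwoBoundarySqueeze all
ASSUME growing-radius certification inside a capture crux; here it is a separate deterministic
theorem with a named, model-checked mechanism, the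
gauge packaging is proved or landed, and the causal clause is discharged (E, proved) by a
seam-and-first-entry argument needing no early control.

RANKED CRUXES. #2 NeckGapDecay (crux, stmt-18059, rev 5; the physics half of NecksCertifyR; =
PosGap) — for EVERY admissible datum, MGHD 𝒟, C⁴ decomposition d of
O = exteriorOf 𝒟 d.charted with HonestCore(d,R₀), HonestFar(d,R₀) and pairwise distinct hole
velocities, and every hole i: ∃ R₁ ≥ R₀, τ₁ ≥ τ₀,
a continuous flat-time wall W with 3ρᵢ + 2 ≤ W after τ₁ (the factor 3 buys a PHYSICAL overlap shell
of width ≳ ρᵢ with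
the flat chart's certified image even for an honest flat chart drifted by |ξ| < ρᵢ, AUDIT-c4
(B)(C)), and a chart Ψg of the late model tube {τ₁ < tᵢ, rᵢ < W(x⁰)+1} — smooth open embedding
into d.charted (G1), = Ψᵢ inside R₁+1 (G2) — with sup-C² deviation from boosted Kerrᵢ on {tᵢ = τ, rᵢ
≤ W(x⁰)} → 0 (G3), future-directed
Λᵢe₀-lines on R₁ ≤ rᵢ ≤ W(x⁰) from τ₁ (G4), relatively closed sub-wall late tube portions (G5). WHY
THIS FORM IS EASIER: deterministic, one
scale-free annulus per hole at r ≥ 100Mᵢ, all smallness typed and rate-free, the lever above with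
its linear model proved; attack = the
registered physics stub stub_neckLedgerAnalysisPos of Lines/two_cap_focusing_ledger.lean
(re-registered against this decl by the crux chain).
First lemmas Monday morning: (i) M2 for the Kerr–Schild wave operator on r ≥ 100M (in-tree
KerrSchild.waveOperator; backscatter as Duhamel);
(ii) the order-1 cone ledger from Hawking-mass monotonicity on far outgoing cones (HasHawkingFlux /
hawkingMass_monotone vocabulary in tree).
[difficulty: open-problem-adjacent — a late-time, annular, large-C⁰-data piece of exterior
stability; XL] (why it might fail: the order-3 ledger
entry for ANGULARLY wild o₂ data — the one place the W-test was not run — or refocused nonlinearly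
generated incoming radiation (Luk–Oh
corrections); a NON-STARVING NECK refutes it.) [KlainermanRodnianski2007,
KlainermanRodnianski2010Breakdown, arXiv:1204.1767, LukOh2024, Shen2024
Thm 1.6/1.7 pp. 8–9, CaciottaNicolo2010, KlainermanNicolo2003, ChristodoulouKlainerman1993,
DafermosHolzegelRodnianskiTaylor2021]
#3 HonestFixedRadiusSettlingT (crux; the generic import, unchanged) — TAME-Christodoulou-generic
admissible data: MGHD, complete 𝓘⁺ (sojourn
form), honest C⁴ decomposition of O = exteriorOf with RaysStayInClosure, HonestCore ∧ HonestFar,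
distinct velocities; fixed-radius convergence and
the flat zone are the structure's own clauses, NOTHING on the necks. WHY THIS FORM IS EASIER:
fixed-radius C^k convergence is what capture
theorems output (DHRT, KS, GKS: {r ≤ R} for each fixed R, to high finite order), so G removes
exactly the radius-uniformity this route proves elsewhere; C⁴ vs C²
is free; comoving final pairs are codimension ≥ 1 (threshold recession); shared in substance with
every capture route. What transfers from the
rev-1 lines: the sojourn CERT lemmas (p84922, p93773, p85628, p87144, p105561: honest decomposition
⇒ complete 𝓘⁺) verbatim; far-field surgery
only charge-matched. [difficulty: open-problem] (why it might fail: most of the conjecture,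
tame-generically, at once — naked singularities,
cascades of small holes, wandering velocities, extremal or comoving limits refute it.)
[DafermosLuk2017, GiorgiKlainermanSzeftel2022,
arXiv:2104.08222, Christodoulou2008, arXiv:0811.0354, arXiv:2402.10190, Christodoulou1999]
#4 SeamedChartsExhaust (crux, PROVED p128314
…Theorems.SeamedChartsExhaust.WideAnchoring.seamedChartsExhaust).
#5 FutureOrientedOfSeamed (crux, deterministic, L): HonestCore ∧ SEAMED ⇒ IsFutureOriented — (i)
orthochronous = HonestCore (a); (iii) flat ∂₀
future = HonestCore (d) (bridge kernel-checked, OrientKitC6 isFutureOriented_of_clauses); (ii)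
dΨᵢ(ΛᵢV) timelike on truncated slabs by the
structure's C² convergence, constant orientation on connected slabs, future at the anchors R₀' ≤ r ≤
R₀'+4 by SEAMED (4)(5). (why it might
fail: the sign must propagate along connected slabs down to r₊ and beyond Rᵢ+1; fails if a slab
disconnects or the field goes null en route.)
[arXiv:0811.0354, ONeill1983, DafermosLuk2017, arXiv:1111.0400]
#6 GapDecaySuffices (crux, stmt-18060, rev 5; the gauge half of NecksCertifyR; = PosSoft ∘ landed):
NeckGapDecay → NecksCertifyR. Gauge geometry, no PDE, provable
now, XL: belt-trick unwinding in SO(3)/S³ of the unbounded relative rotation, logarithmic radial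
blending, drift/boost blending on [ρₐ,4ρₐ] with
ρₐ ≫ drift (honest exotic families (A)(B)(C) of AUDIT-c4 §2 all absorbed), Lorentzian transition-map
rigidity with an a-priori ‖DT‖ bound from
the timelike legs (Riemannian half landed: ADMTransitionRigidity.norm_snd_le_of_law,
ADMTransitionRotation.exists_rotation;
LocalIsometryJetRigidity), open-embedding / closedness / covering bookkeeping; then
necksCertifyR_of_neckLedgerAnalysisPos (p131681) —
composition kernel-checked (Sketch.lean gapDecaySuffices_of_posSoft). (why it might fail:
Liouville/FJM rigidity degrades on thin shells of
radius ρ → ∞, so the blend needs length ≳ ρ and log-room 4ρₐ/ρ → ∞ — available since ρ = o(t) — and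
a too-weak GapCertificate clause would make
it misstated: repair NeckGapDecay's G4/G5, not the physics.) [FrieseckeJamesMuller2002, ONeill1983,
DafermosLuk2017]
#2 NecksCertifyR (the cut item: implied by NeckGapDecay ∧ GapDecaySuffices, no longer a `closes`
hypothesis since rev 6, kept as a crux
decl only because GapDecaySuffices names it and render order forbids a support placed after it;
claimable directly at low priority — its one
registered stub Pos closes it by p131681; crux staffing should key on NeckGapDecay). #9 supports:
DiagonalRadii (PROVED),
KerrSchildTailDecay (PROVED), and the superseded rev-1 edges HonestFixedRadiusSettling /
NecksCertify / rev-1 Assembly (kept for landed dependents; do not staff).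

TWO-LAYER PLAN. FILED (rev 5/6, as top-level cruxes; a formal `--split` of NecksCertifyR is reserved
to a final/tenure seat and would
merely re-parent the same two decls): S ⇐ NeckGapDecay → GapDecaySuffices → NecksCertifyR (`fun h₁
h₂ ↦ h₂ h₁`, used inside `closes`).
Below the two cruxes only `--supports` lemmas (D-0019): for NeckGapDecay the v5 skeleton's rungs
(M2-KS, far ledger orders 1–3, KR neck step, gauge (4));
for GapDecaySuffices the toolkit s1–s5. FutureOrientedOfSeamed ⇐ TimelikeOnSlabs →
OrientationPropagates if a prover asks (not filed).
HonestFixedRadiusSettlingT is the import and is split only by the routes that own capture.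

KILL CRITERIA. (1) NeckGapDecay dies by a NON-STARVING NECK: an admissible vacuum development, or a
rigorous model computation accepted by refuters
(nonlinear Luk–Oh tail on a dynamical Schwarzschild-like background, arXiv:2404.02220 §8–9), in
which the unweighted C² deviation on
{Rg(τ) < r ≤ ρ(τ)} does not tend to 0 for some sublinear ρ although the near zone converges at every
fixed radius, the far zone is flat-certified
and the holes do not comove — `close --reason refuted:NeckGapDecay`; it would be a statement-level
finding for EVERY exhaustiveness clause of the
sub-problem (a barrier candidate: "necks are not Minkowskian at the C² level"). (2) CHEAP, this
week: the lever's own currency — an admissible o₂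
datum with angularly wild profile (ℓ(v) → ∞) whose cone-shell flux at order 3 per unit ρ does NOT
tend to 0 while all certificates hold (one kit
job in the style of j010237): this kills the [cone] hypothesis of M2 at order 3 as typed (repair:
the mixed ∂ᵥ-weighted order-3 entry) and
re-rates the attack, without touching the crux. (3) GapDecaySuffices dies only as MISSTATED (a
fourth exotic honest gauge beyond AUDIT-c4 (A)(B)(C)
breaking K6 one-atlas, or G4/G5 too weak): repair by a new item, not a kill. (4)
FutureOrientedOfSeamed dies only as a typing defect of
SEAMED/orientation (repair: move clause (ii) into HonestCore, OrientKitC6). (5)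
HonestFixedRadiusSettlingT refuted (tame-generic naked
singularities, cascades, generic comoving pairs) kills every fixed-radius route at once: hand the
witness to the negatives index and close.
A proof of FinalStateConjecture by any route supersedes; growing-radius capture proved inside
TangentConeAtIPlus.KerrCaptureOnRays makes S a
corollary there but does not moot this route (different G).

NOT DECOMPOSED YET. Inside G: censorship, finiteness of N, asymptotic velocities, fixed-radius
no-hair, horizon normalisation, the rays clause
(owned by capture routes / cards). Inside NeckGapDecay (skeleton stubs, never items): M2 on
Kerr–Schild backgrounds; the far cone ledger at
orders 1 (Hawking-mass monotonicity), 2 (once-commuted flux, finite for o₂), 3 (incoming by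
interpolation o₂ × flat C⁴, outgoing by continuity
in t through the neck — why supplier and neck are ONE stub); the KR parametrix step with
conjugacy/injectivity radius from flux on cones of
length ≍ ρ inside {r ≥ 100M}; the ℓ = 0 window-energy drift ∫ L(t−r)dr/r ≤ E_window/R₀ (no log,
TRIAGE r1-2 §A); the gauge on the gap; N ≥ 2
lensing-pencil excision O(Mⱼ/(vᵢⱼ²t)) under DV. Inside GapDecaySuffices: s1–s5. Inside F:
TimelikeOnSlabs / OrientationPropagates. No rates
anywhere (o(1), tails of convergent integrals, Cauchy differences), by design (PriceLawTail).

CHEAPEST FALSIFIER. (1) The order-3 angular W-test above (one kit job; the radial W-test j010237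
already passed every order ≤ 3 and denied only
over-weighted currencies no item uses). (2) One page: M2 with the Regge–Wheeler/Kerr–Schild
potential — does the Huygens neck lemma survive
backscatter? The Duhamel term of Vψ, V = O(M/r³), over the backward solid cone ∩ {r ≥ R₀} is ≤
sup|ψ| · O(M/t) for the cylinder-borne sector
(TRIAGE r1-1 §C: ∫_{t/4}^∞ s|V| ds = O(M/t)); a failure here kills the nonlinear step before any
Einstein analysis. (3) Instantiate NeckGapDecay,
SEAMED, HasExhaustiveCharts and IsFutureOriented on exact boosted Schwarzschild v = 0.9 in
Kerr–Schild coordinates with an OFF-CENTRED, slowly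
ROTATING honest flat chart (AUDIT-c4 families (A)(B): Φ∘R_{ϑ}, ϑ = log log u; drift ½ρ(t)ê₁): every
clause must hold with W = 3ρ+2, Ψg = identity,
margins 1/2/4, thresholds 1/10 and 1/(10‖Λ‖²) (‖Λ‖² = 19 at v = 0.9), clock offset c⁰ ≈
γv(R+3)/(1−1/γ); the rev-1 refuter instantiation
(Theorems/SeamedChartsExhaust/Negative/ExactSchwarzschild*) passed for S/E. (4) Lookup DONE (held
texts): Shen arXiv:2303.12758 Thm 1.6/1.7
(pp. 8–9) and Caciotta–Nicolò 2010 develop external regions from CAUCHY data outside I⁺(K) only — no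
inner interface — so NeckGapDecay is not
`known`; Luk–Oh §1.2.4 localises the intermediate zone by strong Huygens exactly as M2 does
(precedent, not a proof: their input is assumed
decay on a fixed dynamical background).

NUMBERS. Typed thresholds (all satisfiable on exact boosted Kerr): R₀ ≥ 100 max Mᵢ (Kerr(T,T) ≤ −(1
− 2M/(r−|a|)) ≤ −0.97, H ≤ 0.0101, ‖V‖ ≤ 1.03,
g_Kerr(e₀,V) = −1); C⁰ thresholds 1/10 (flat) and 1/(10‖Λᵢ‖²) (holes; pure boost ‖Λ‖² =
(1+v)/(1−v)); margins: wall W ≥ 3ρᵢ + 2 (physical overlap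
shell ≳ ρᵢ with the flat-certified image; drift |ξ| < ρᵢ by tube containment), tube U out to W + 1,
near zone untouched inside R₁ + 1, SEAMED flat tube + 2 ≤ certified radius, seam collar 1, clock
lag + 2, certified tubes + 1 disjoint, Rᵢ ≥ R₀ + 4 ≥ max(r₊,0) + 1; cone shell radii [4ρ, 5ρ], far
sphere |z| ∈ [3ρ, 6ρ], analysis region ≤ 9ρₐ,
one atlas from 4ρₐ; derivative budget C⁴ (G) → C³ cylinder / C² output (one derivative = the
ledger); W-test (TRIAGE r1-2 §W, j010237): at the
wall, order k tolerates weight w ≤ 1 + (4−k)/θ — order 2 weight 2 ✓ (and SMALL), order 3 weight 2 ✓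
/ weight 3 ✗ for θ > 1/2, order 4 weight 1 ✓;
the crux's own currency (unweighted C² → 0) is untouched. Items after rev 6: 11 (cruxes
NecksCertifyR [cut, unused by closes], NeckGapDecay, HonestFixedRadius-
SettlingT, SeamedChartsExhaust [proved], FutureOrientedOfSeamed, GapDecaySuffices; supports
DiagonalRadii [proved], KerrSchildTailDecay [proved]
and 3 superseded rev-1 edges incl. the rev-1 Assembly decl); deciding theorem `closes` with 5
hypotheses (G, NeckGapDecay, GapDecaySuffices,
E, F), proved, authority native.

DEFINITION REQUESTS. None new: NeckGapDecay is typed over existing declarations (supCkENorm /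
deviationExtend / truncDeviationCk of
KerrConvergence, IsOpenEmbedding, mfderiv); the earlier D1 ShellDeviation / D2 TubeLuminosity
requests are superseded by the cone ledger, whose
model currency is already typed inside the landed M2 (iteratedFDeriv over the cone shell) and whose
nonlinear currency (Bel–Robinson / Hawking
flux) uses the tree's TimelikeTube.energyFlux and NullHypersurface.hawkingMass vocabulary inside the
proof, not in any statement.

Novelty: Searches (rev 1, 2026-08-15, kept): the sub's Theses read for a neck/annulus engine (none); `lit
search --hybrid "nonlinear stability Kerr
external region far from the black hole"`; `--source crossref "Kerr spacetime external regions
nonlinear stability"` (Shen Annals PDE 2024 =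
arXiv:2303.12758; Caciotta–Nicolò AHP 2010); `lit galaxy search --star all` ×4 (0 rows); card audit
new-combination confirmed. Rev 4 (promote-to-A,
2026-08-16, for THE LEVER): `lit search --hybrid "Kirchhoff Sobolev parametrix curvature flux
pointwise bound intermediate region"` (8 book hits,
none on point: Ashtekar–Berger–Isenberg 2015, KS2020 polarized, Rendall 2008); `lit search --hybrid
"strong Huygens principle intermediate zone late
time asymptotics black hole exterior"` (Hawking–Ellis, Daudé–Häfner–Nicolas 2017 — no neck
statement); `lit galaxy search "Kirchoff-Sobolev
parametrix" --star all` (2 rows: a PDE proceedings volume, Kurylev–Lassas–Uhlmann inverse problems —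
irrelevant); `lit galaxy search "no energy
concentrates in the intermediate zone" --star all` (0); `lit search --source arxiv "Kirchhoff
Sobolev parametrix Einstein vacuum curvature flux
late time decay exterior"` (0); `lit citing doi:10.1142/s0219891607001203` (31 citers:
breakdown/continuation criteria KR 2010, Shao 2011, Wang
2012; Yang–Mills global existence and large-data decay arXiv:1312.5476, arXiv:1902.08519,
arXiv:2401.13949; none in late-time black-hole
asymptotics); held texts READ: Luk–Oh arXiv:2404.02220 p. 13 §1.2.4  [refs: 10.1142/s0219891607001203`, 10.1007/s00023-010-0032-9, 2303.12758, 1312.5476, 1902.08519, 2401.13949, 2404.02220, math/0603009, doi:10.1142/s0219891607001203, doi:10.1007/s00023-010-0032-9, KlainermanRodnianski2007]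

Barriers (technique_class: huygens-radius-rho,cone-ledger,KS-parametrix,causal-seam): - technique_class: huygens-radius-rho,cone-ledger,KS-parametrix,causal-seam
- Literature.Barriers.FinalStateConjecture.SbierskiTrappingObstruction: trapping itself is not
engaged — every estimate lives on r ≥ R₀ ≥ 100M, outside the photon region by a factor > 30, and no
local-energy-decay statement near trapping is made (near-zone convergence is imported at fixed radii
inside G). Its companion fact `KerrNullGeodesicGaussianBeams` (Sbierski 2015,
TrappingDerivativeLossGeodesicBeams.lean) is the declared ENEMY of every neck sup bound and is met
exactly by the lever's currency: a beam with pericentre in the neck carries NON-starved commuted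
cone flux per unit ρ (≈ 4πρ: Cauchy–Schwarz is sharp for a converging shell), so hypothesis [cone]
fails where the conclusion is false — consistent; beams focusing inside the fat collar are invisible
to the L² ledger; DATA-borne beams aimed at late necks are excluded by o₂ at radius ≈ t with one
power of t to spare (TRIAGE r1-1 §B(4), r1-2 §W); bounded energy of any commutation order is never
used as smallness (refuted currency, r1-1 §B(3)).
- Literature.Barriers.FinalStateConjecture.WaveCoordinatesNullConditionFailure: the nonlinear neck
step works with curvature (Bianchi, □_g Riem = Riem⋆Riem) through the COVARIANT
Klainerman–Rodnianski parametrix and CK/KN null-frame transport — the catalogued evasions; no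
wave-coordinate null-condition iteration; M2's isotropic currency is legitimate because the cone
shell sits in the flat-certified zone.

History (route lifecycle, newest last):
- 2026-08-17T00:16:05Z · rev 7: restated NeckGapDecay (stmt-FinalStateConjecture-18059) — promote-to-A: sharpen NeckGapDecay's wall clause W >= rho_i+2 -> W >= 3rho_i+2 (guarantees a PHYSICAL overlap shell of width >~ rho_i between the hole-anchored (planner-promote-FinalStateConjecture-StarvedNe-af37d317-0)
- 2026-08-25T09:58:45Z · DORMANT — reconciler: no traction for 7.6 d (last activity item-evidence-added at 2026-08-17T19:10:44Z); parked, not closed — `ledger route dormant route-FinalStateConjec (operator:999:2387532)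

sub-problem: FinalStateConjecture · status: dormant · opened planner-plancard-FinalStateConjecture-FinalSt-735183a3-0 2026-08-15T19:22:36Z · rev 11 · ledger route-FinalStateConjecture-StarvedNecks
GENERATED by the gate from the ledger (D-0016/17). Provers cite these decls: `theorem foo : Summit.FinalStateConjecture.FinalStateConjecture.Theses.StarvedNecks.<Decl> := …` in Summits/FinalStateConjecture/FinalStateConjecture/Theorems/<Name>.lean.
-/

namespace Summit.FinalStateConjecture.FinalStateConjecture.Theses.StarvedNecks

open scoped BigOperators Topology Manifold Classical MeasureTheory ProbabilityTheory Matrix InnerProductSpace ComplexConjugate ContinuousMap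
open Filter Set Function TopologicalSpace MeasureTheory

attribute [summit_statement] _root_.FinalStateConjecture

-- earlier NeckGapDecay (stmt-FinalStateConjecture-18059, replaced 2026-08-17T00:16:05Z -> stmt-FinalStateConjecture-16768): retired by None — open Literature.Geometry.Lorentzian in open scoped ContDiff ENNReal in let Hc:=(fun (𝓢 : Spacetime.{0} 4) (O : Set 𝓢.carrier) (k : ℕ) (d : FinalStateDecomposition 𝓢 O k) (R₀ : ℝ)=>let B:=d.background; let t:=fun i↦(B i).time; let r:=fun i↦(B i).radius; let Ψ:=
/-- item stmt-FinalStateConjecture-16768 · crux · rank 2 · open · by planner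
why it might fail: Needs the commuted cone-shell flux per unit wall radius -> 0 at orders 1-3 from o2 data + certificates (order-3 entry for angularly wild o2 data unverified, TRIAGE r1-2 W-test) and no refocused nonlinearly generated incoming radiation (Luk-Oh); a non-starving neck refutes it
sources: KlainermanRodnianski2007, KlainermanRodnianski2010Breakdown, arXiv:1204.1767, LukOh2024, Shen2024, CaciottaNicolo2010
[crux] PosGap = the PHYSICS of the deciding crux, isolated (lead census AUDIT-c4 §3): for EVERY
admissible datum, MGHD, honest C⁴ decomposition (HonestCore, HonestFar, distinct hole velocities)
and EVERY hole i, the GAP ANNULUS {Rg(τ) < rᵢ ≤ ρᵢ} between the fixed-radius-certified near zone and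
the flat-certified radiation zone — where the input gives only C⁰ control — is C²-CERTIFIED: a chart
Ψg of the late tube {τ₁ < tᵢ, rᵢ < W(x⁰)+1} (W continuous, ≥ 3ρᵢ+2: the certified image then
overlaps the flat chart's certified image in a PHYSICAL shell of width ≳ ρᵢ even for an honest flat
chart drifted by |ξ| < ρᵢ, AUDIT-c4 (B)(C)), smooth open embedding into d.charted, = Ψᵢ inside R₁+1,
with C² deviation from boosted Kerrᵢ → 0 on the hole slabs out to W, future-directed Λᵢe₀-lines and
relatively closed sub-wall tube portions. One scale-free annulus per hole at r ≥ 100Mᵢ: no trapping,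
ergoregion, horizon or seam. THE ATTACK (line two-cap-focusing-ledger v5,
stub_neckLedgerAnalysisPos): HUYGENS AT RADIUS ρ — cut off at the certified collar, so a gap point
is fed only by the certified cylinder (Duhamel at retarded time t−5ρ → ∞) and by its backward cone
shell at radii [4ρ,5ρ] lying in the f -/
@[route_item "route-FinalStateConjecture-StarvedNecks", crux]
def NeckGapDecay : Prop :=
  open Literature.Geometry.Lorentzian in open scoped ContDiff ENNReal in let Hc:=(fun (𝓢 : Spacetime.{0} 4) (O : Set 𝓢.carrier) (k : ℕ) (d : FinalStateDecomposition 𝓢 O k) (R₀ : ℝ)=>let B:=d.background; let t:=fun i↦(B i).time; let r:=fun i↦(B i).radius; let Ψ:=d.chart; (∀ i, Kerr.IsSubextremal (d.mass i) (d.spin i) ∧ 100 * d.mass i ≤ R₀ ∧ 0 < ((d.motion i).1 : E4 ≃L[ℝ] E4) (E4.basisVector 0) 0) ∧ (∀ i (ϱ τ₂ : ℝ), R₀ ≤ ϱ → d.τ₀ < τ₂ → Ψ i '' {x | d.τ₀ < t i x.1 ∧ t i x.1 < τ₂ ∧ r i x.1 < ϱ} ⊆ 𝓢.metric.causalPast 𝓢.timeOrientation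 (Ψ i '' (B i).truncTimeSlab ϱ τ₂)) ∧ (∀ i (τ' : ℝ) (ϱ : ℝ → ℝ), Continuous ϱ → d.τ₀ < τ' → let A:=Ψ i '' {x | τ' ≤ t i x.1 ∧ r i x.1 ≤ ϱ (t i x.1)}; closure A ∩ O ⊆ A) ∧ (∀ y : d.flatDomain, d.τ₀ < y.1 0 → 𝓢.timeOrientation.IsFutureDirected (mfderiv 𝓘(ℝ, E4) (𝓡 4) d.flatChart y (E4.basisVector 0)))); let Hf:=(fun (𝓢 : Spacetime.{0} 4) (O : Set 𝓢.carrier) (k : ℕ) (d : FinalStateDecomposition 𝓢 O k) (R₀ : ℝ)=>let B:=d.background; let t:=fun i↦(B i).time; let r:=fun i↦(B i).radius; let Φ:=d.flatChart; (∀ τ₂ : ℝ, d.τ₀ < τ₂ → Φ '' {y | d.τ₀ < y.1 0 ∧ y.1 0 < τ₂} ⊆ 𝓢.metric.causalPast 𝓢.timeOrientation (Φ '' (Minkowski.backgroundOn d.flatDomain).timeSlab τ₂)) ∧ (∀ τ' : ℝ, d.τ₀ < τ' → closure (Φ '' {y | τ' ≤ y.1 0 ∧ ∀ i, d.excision i (y.1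 0) + 1 ≤ r i y.1}) ⊆ Φ '' {y | τ' ≤ y.1 0}) ∧ (∀ i, ∃ T : ℝ, supCkENorm (Subtype.val '' {x : (B i).domain | T ≤ t i x.1 ∧ R₀ ≤ r i x.1 ∧ ∀ j, j ≠ i → r i x.1 ≤ r j x.1}) 0 (𝓢.deviationExtend (B i) (d.chart i)) ≤ ENNReal.ofReal (1 / (10 * ‖(((d.motion i).1 : E4 ≃L[ℝ] E4) : E4 →L[ℝ] E4)‖ ^ 2)))); ∀ (X : Type) [TopologicalSpace X] [ChartedSpace E3 X] [IsManifold (𝓡 3) ∞ X] [ConnectedSpace X] (D : InitialDataSet (𝓡 3) X), D ∈ admissibleVacuumData X → ∀ 𝒟 : VacuumCauchyDevelopment D, 𝒟.IsMaximal → ∀ (O : Set 𝒟.carrier) (d : FinalStateDecomposition 𝒟.toSpacetime O 4) (R₀ : ℝ), O = exteriorOf 𝒟.toCauchyDevelopment d.charted → Hc 𝒟.toSpacetime O 4 d R₀ → Hf 𝒟.toSpacetime O 4 d R₀ → (∀ i j : Fin d.N, i ≠ j → ((d.motion i).1 : E4 ≃L[ℝ] E4) (E4.basisVector 0) ≠ ((d.motion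 j).1 : E4 ≃L[ℝ] E4) (E4.basisVector 0)) → ∀ i : Fin d.N, ∃ (R₁ τ₁ : ℝ) (W : ℝ → ℝ) (Ψg : (d.background i).domain → 𝒟.carrier), let B:=d.background i; let t:=B.time; let r:=B.radius; R₀ ≤ R₁ ∧ d.τ₀ ≤ τ₁ ∧ Continuous W ∧ (∀ s, τ₁ ≤ s → 3 * d.excision i s + 2 ≤ W s) ∧ (let U : Set B.domain := {x | τ₁ < t x.1 ∧ r x.1 < W (x.1 0) + 1}; ContMDiffOn 𝓘(ℝ, E4) (𝓡 4) ∞ Ψg U ∧ Topology.IsOpenEmbedding (U.restrict Ψg) ∧ Ψg '' U ⊆ d.charted) ∧ (∀ x : B.domain, r x.1 ≤ R₁ + 1 → Ψg x = d.chart i x) ∧ Tendsto (fun τ ↦ supCkENorm (Subtype.val '' {x : B.domain | t x.1 = τ ∧ r x.1 ≤ W (x.1 0)}) 2 (𝒟.toSpacetime.deviationExtend B Ψg)) atTop (𝓝 0) ∧ (∀ x : B.domain, τ₁ ≤ t x.1 → R₁ ≤ r x.1 → r x.1 ≤ W (x.1 0) → 𝒟.toSpacetime.timeOrientation.IsFutureDirected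 (mfderiv 𝓘(ℝ, E4) (𝓡 4) Ψg x (((d.motion i).1 : E4 ≃L[ℝ] E4) (E4.basisVector 0)))) ∧ (∀ (τ' : ℝ) (ϱ : ℝ → ℝ), Continuous ϱ → τ₁ < τ' → (∀ x : B.domain, τ' ≤ t x.1 → r x.1 ≤ ϱ (t x.1) → r x.1 ≤ W (x.1 0)) → closure (Ψg '' {x | τ' ≤ t x.1 ∧ r x.1 ≤ ϱ (t x.1)}) ∩ O ⊆ Ψg '' {x | τ' ≤ t x.1 ∧ r x.1 ≤ ϱ (t x.1)})

/-- item stmt-FinalStateConjecture-17574 · crux · rank 2 · open · by planner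
why it might fail: Influx through r=R0 and neck-born nonlinear tails (Luk-Oh) must be o(1) in SCALE-INVARIANT C^3 norms, yet the input certifies unweighted norms at fixed radii and outside its tubes only (gap data C^0-controlled); exterior Kerr stability (Caciotta-Nicolo, Shen Thm 1.6-1.7) lives outside I+(K) only
sources: arXiv:2303.12758, doi:10.1007/s00023-010-0032-9, arXiv:2404.02220, KlainermanNicolo2003, arXiv:2211.15230, arXiv:0904.0620
[crux] (repaired rev-1 NecksCertify = card K1+K2 with the K3 input; ONE inserted antecedent:
pairwise distinct asymptotic four-velocities, (∀ i j, i ≠ j → (d.motion i).1 e₀ ≠ (d.motion j).1 e₀)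
— without it the statement is false modulo ComovingPairWitness / EqualVelocityBinaryWitness, p73407;
Hc/Hf/Sm byte-identical to rev 1, text = Cruxes/NecksCertify/Restated.lean `NecksCertifyR`,
whitespace-compressed to the gate's 4000-char cap — token-identical, so
`necksCertifyR_of_neckLedgerAnalysisPos` transfers by `exact`) for EVERY admissible datum, every
MGHD 𝒟, every C⁴ final-state decomposition d of O with O = exteriorOf 𝒟 d.charted, HonestCore(d,
R₀), HonestFar(d, R₀) and distinct velocities: there are a C² decomposition d₂ of the same O with O
= exteriorOf 𝒟 d₂.charted and HonestCore(d₂, R₀'), radii Rᵢ (monotone, continuous, ≥ R₀'+4) and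
SEAMED(d₂, R, R₀') (flat tubes ≥ R₀'; C² certification of each hole chart out to Rᵢ(τ); C⁰
thresholds 1/10 and 1/(10‖Λᵢ‖²) and future-oriented hole time-lines on the certified tubes; ONE
ATLAS outside the flat tubes within Rᵢ+1; flat-late domain = tube complement; flat tubes deep
(margin 2) inside certified tubes; hole clocks ≤ flat clock on certifi -/
@[route_item "route-FinalStateConjecture-StarvedNecks", crux]
def NecksCertifyR : Prop :=
  open Literature.Geometry.Lorentzian in open scoped ContDiff ENNReal in let Hc:=(fun (𝓢 : Spacetime.{0} 4) (O : Set 𝓢.carrier) (k : ℕ) (d : FinalStateDecomposition 𝓢 O k) (R₀ : ℝ)=>let B:=d.background; let t:=fun i↦(B i).time; let r:=fun i↦(B i).radius; let Ψ:=d.chart; (∀ i, Kerr.IsSubextremal (d.mass i) (d.spin i) ∧ 100 * d.mass i ≤ R₀ ∧ 0 < ((d.motion i).1 : E4 ≃L[ℝ] E4) (E4.basisVector 0) 0) ∧ (∀ i (ϱ τ₂ : ℝ), R₀ ≤ ϱ → d.τ₀ < τ₂ → Ψ i '' {x | d.τ₀ < t i x.1 ∧ t i x.1 < τ₂ ∧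 r i x.1 < ϱ} ⊆ 𝓢.metric.causalPast 𝓢.timeOrientation (Ψ i '' (B i).truncTimeSlab ϱ τ₂)) ∧ (∀ i (τ' : ℝ) (ϱ : ℝ → ℝ), Continuous ϱ → d.τ₀ < τ' → let A:=Ψ i '' {x | τ' ≤ t i x.1 ∧ r i x.1 ≤ ϱ (t i x.1)}; closure A ∩ O ⊆ A) ∧ (∀ y : d.flatDomain, d.τ₀ < y.1 0 → 𝓢.timeOrientation.IsFutureDirected (mfderiv 𝓘(ℝ, E4) (𝓡 4) d.flatChart y (E4.basisVector 0)))); let Hf:=(fun (𝓢 : Spacetime.{0} 4) (O : Set 𝓢.carrier) (k : ℕ) (d : FinalStateDecomposition 𝓢 O k) (R₀ : ℝ)=>let B:=d.background; let t:=fun i↦(B i).time; let r:=fun i↦(B i).radius; let Φ:=d.flatChart; (∀ τ₂ : ℝ, d.τ₀ < τ₂ → Φ '' {y | d.τ₀ < y.1 0 ∧ y.1 0 < τ₂} ⊆ 𝓢.metric.causalPast 𝓢.timeOrientation (Φ '' (Minkowski.backgroundOn d.flatDomain).timeSlab τ₂)) ∧ (∀ τ' : ℝ, d.τ₀ < τ'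 → closure (Φ '' {y | τ' ≤ y.1 0 ∧ ∀ i, d.excision i (y.1 0) + 1 ≤ r i y.1}) ⊆ Φ '' {y | τ' ≤ y.1 0}) ∧ (∀ i, ∃ T : ℝ, supCkENorm (Subtype.val '' {x : (B i).domain | T ≤ t i x.1 ∧ R₀ ≤ r i x.1 ∧ ∀ j, j ≠ i → r i x.1 ≤ r j x.1}) 0 (𝓢.deviationExtend (B i) (d.chart i)) ≤ ENNReal.ofReal (1 / (10 * ‖(((d.motion i).1 : E4 ≃L[ℝ] E4) : E4 →L[ℝ] E4)‖ ^ 2)))); let Sm:=(fun (𝓢 : Spacetime.{0} 4) (O : Set 𝓢.carrier) (d : FinalStateDecomposition 𝓢 O 2) (R : Fin d.N → ℝ → ℝ) (R₀ : ℝ)=>let B:=d.background; let t:=fun i↦(B i).time; let r:=fun i↦(B i).radius; let Λ:=fun i↦((d.motion i).1 : E4 ≃L[ℝ] E4); let Φ:=d.flatChart; let Ψ:=d.chart; let ρ:=d.excision; (∀ i, Monotone (R i) ∧ Continuous (R i) ∧ ∀ s, R₀ + 4 ≤ R i s ∧ R₀ ≤ ρ i s) ∧ (∀ i, Tendsto (fun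 τ↦𝓢.truncDeviationCk (B i) (Ψ i) 2 (R i τ) τ) atTop (𝓝 0)) ∧ supCkENorm (Subtype.val '' {y : d.flatDomain | d.τ₀ ≤ y.1 0}) 0 (𝓢.deviationExtend (Minkowski.backgroundOn d.flatDomain) Φ) ≤ 10⁻¹ ∧ (∀ i, supCkENorm (Subtype.val '' {x : (B i).domain | (d.τ₀ ≤ t i x.1 ∨ d.τ₀ ≤ x.1 0) ∧ R₀ ≤ r i x.1 ∧ r i x.1 ≤ R i (t i x.1)}) 0 (𝓢.deviationExtend (B i) (Ψ i)) ≤ ENNReal.ofReal (1 / (10 * ‖(Λ i : E4 →L[ℝ] E4)‖ ^ 2))) ∧ (∀ i (x : (B i).domain), (d.τ₀ ≤ t i x.1 ∨ d.τ₀ ≤ x.1 0) → R₀ ≤ r i x.1 → r i x.1 ≤ R i (t i x.1) → 𝓢.timeOrientation.IsFutureDirected (mfderiv 𝓘(ℝ, E4) (𝓡 4) (Ψ i) x ((Λ i) (E4.basisVector 0)))) ∧ (∀ i (y : E4) (hy : y ∈ (B i).domain), d.τ₀ ≤ y 0 → (∀ j, ρ j (y 0) < r j y) → r i y ≤ R i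 (t i y) + 1 → ∃ hy' : y ∈ d.flatDomain, Ψ i ⟨y, hy⟩ = Φ ⟨y, hy'⟩) ∧ (∀ y : d.flatDomain, d.τ₀ ≤ y.1 0 → ∀ j, ρ j (y.1 0) < r j y.1) ∧ (∀ j (y : E4), d.τ₀ ≤ y 0 → r j y ≤ ρ j (y 0) → r j y + 2 ≤ R j (t j y)) ∧ (∀ j (y : E4), d.τ₀ ≤ t j y → r j y ≤ R j (t j y) + 2 → t j y ≤ y 0) ∧ (∀ j, Ψ j '' {x | d.τ₀ < t j x.1 ∧ R j (t j x.1) + 1 < r j x.1} ⊆ d.radiationZone) ∧ (∀ τ' : ℝ, d.τ₀ < τ' → closure (Φ '' {y | τ' ≤ y.1 0}) ⊆ Φ '' {y | τ' ≤ y.1 0} ∪ ⋃ j, Ψ j '' {x | τ' ≤ x.1 0 ∧ r j x.1 = ρ j (x.1 0)}) ∧ (∀ j j' (y : E4), j ≠ j' → (d.τ₀ ≤ y 0 ∨ d.τ₀ ≤ t j y) → r j y ≤ R j (t j y) + 1 → R j' (t j' y) + 1 < r j' y)); ∀ (X : Type) [TopologicalSpace X] [ChartedSpace E3 X] [IsManifold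 (𝓡 3) ∞ X] [ConnectedSpace X] (D : InitialDataSet (𝓡 3) X), D ∈ admissibleVacuumData X → ∀ 𝒟 : VacuumCauchyDevelopment D, 𝒟.IsMaximal → ∀ (O : Set 𝒟.carrier) (d : FinalStateDecomposition 𝒟.toSpacetime O 4) (R₀ : ℝ), O = exteriorOf 𝒟.toCauchyDevelopment d.charted → Hc 𝒟.toSpacetime O 4 d R₀ → Hf 𝒟.toSpacetime O 4 d R₀ → (∀ i j : Fin d.N, i ≠ j → ((d.motion i).1 : E4 ≃L[ℝ] E4) (E4.basisVector 0) ≠ ((d.motion j).1 : E4 ≃L[ℝ] E4) (E4.basisVector 0)) → ∃ (d₂ : FinalStateDecomposition 𝒟.toSpacetime O 2) (R : Fin d₂.N → ℝ → ℝ) (R₀' : ℝ), O = exteriorOf 𝒟.toCauchyDevelopment d₂.charted ∧ Hc 𝒟.toSpacetime O 2 d₂ R₀' ∧ Sm 𝒟.toSpacetime O d₂ R R₀'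

/-- item stmt-FinalStateConjecture-17575 · crux · rank 3 · open · by planner
why it might fail: Most of the conjecture at once, TAME-generically: MGHD, complete scri+, finitely many holes, fixed-radius no-hair to ONE sub-extremal boosted Kerr each, flat radiation zone, honest C^4 charts, rays in closure O, non-comoving holes; naked singularities, cascades, comoving limits refute it
sources: DafermosLuk2017, GiorgiKlainermanSzeftel2022, arXiv:2104.08222, Christodoulou2008, arXiv:0811.0354, arXiv:2402.10190
[crux] (re-typed generic import = rev-1 HonestFixedRadiusSettling with THREE textual edits, texts =
Cruxes/HonestFixedRadiusSettling/RetypeKitC5.lean `HonestFixedRadiusSettlingT` ∘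
Cruxes/NecksCertify/Restated.lean `HonestFixedRadiusSettlingR`: (1) `IsChristodoulouGeneric` ↦
`IsTameChristodoulouGeneric` (witness families on one fixed AF end, wDist-continuous at c = 0,
immersed: the mass-blow-up burial families are excluded); (2) `RaysStayInClosure
𝒟.toCauchyDevelopment O ∧` inserted after the `O = exteriorOf …` clause (dynamics only the generic
import can supply; S/E/F keep O); (3) the distinct-velocity conjunct appended after Hf) for every
admissible 3-manifold X, tame-Christodoulou-generic in admissibleVacuumData X is: D has an MGHD, and
every MGHD 𝒟 has complete future null infinity (sojourn form) and admits O, a C⁴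
`FinalStateDecomposition 𝒟.toSpacetime O 4` d and R₀ with O = exteriorOf 𝒟 d.charted, every
future-complete normalised null ray from Σ in closure O, HonestCore(d, R₀) ∧ HonestFar(d, R₀): every
hole sub-extremal, R₀ ≥ 100 Mᵢ and orthochronous boosts; hole-late points of {r < ϱ} lie in J⁻ of
every later disc {t*ᵢ = τ₂, r ≤ ϱ} (ϱ ≥ R₀); every late tube portion {τ' ≤ t*, -/
@[route_item "route-FinalStateConjecture-StarvedNecks", crux]
def HonestFixedRadiusSettlingT : Prop :=
  open Literature.Geometry.Lorentzian in open scoped ContDiff ENNReal in let Hc := ( fun (𝓢 : Spacetime.{0} 4) (O : Set 𝓢.carrier) (k : ℕ) (d : FinalStateDecomposition 𝓢 O k) (R₀ : ℝ) => let B := d.background; let t := fun i ↦ (B i).time; let r := fun i ↦ (B i).radius; let Ψ := d.chart; (∀ i, Kerr.IsSubextremal (d.mass i) (d.spin i) ∧ 100 * d.mass i ≤ R₀ ∧ 0 < ((d.motion i).1 : E4 ≃L[ℝ] E4) (E4.basisVector 0) 0) ∧ (∀ i (ϱ τ₂ : ℝ), R₀ ≤ ϱ → d.τ₀ < τ₂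 → Ψ i '' {x | d.τ₀ < t i x.1 ∧ t i x.1 < τ₂ ∧ r i x.1 < ϱ} ⊆ 𝓢.metric.causalPast 𝓢.timeOrientation (Ψ i '' (B i).truncTimeSlab ϱ τ₂)) ∧ (∀ i (τ' : ℝ) (ϱ : ℝ → ℝ), Continuous ϱ → d.τ₀ < τ' → let A := Ψ i '' {x | τ' ≤ t i x.1 ∧ r i x.1 ≤ ϱ (t i x.1)}; closure A ∩ O ⊆ A) ∧ (∀ y : d.flatDomain, d.τ₀ < y.1 0 → 𝓢.timeOrientation.IsFutureDirected (mfderiv 𝓘(ℝ, E4) (𝓡 4) d.flatChart y (E4.basisVector 0))) ); let Hf := ( fun (𝓢 : Spacetime.{0} 4) (O : Set 𝓢.carrier) (k : ℕ) (d : FinalStateDecomposition 𝓢 O k) (R₀ : ℝ) => let B := d.background; let t := fun i ↦ (B i).time; let r := fun i ↦ (B i).radius; let Φ := d.flatChart; (∀ τ₂ : ℝ, d.τ₀ < τ₂ → Φ '' {y | d.τ₀ < y.1 0 ∧ y.1 0 < τ₂} ⊆ 𝓢.metric.causalPast 𝓢.timeOrientation (Φ '' (Minkowski.backgroundOn d.flatDomain).timeSlab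 τ₂)) ∧ (∀ τ' : ℝ, d.τ₀ < τ' → closure (Φ '' {y | τ' ≤ y.1 0 ∧ ∀ i, d.excision i (y.1 0) + 1 ≤ r i y.1}) ⊆ Φ '' {y | τ' ≤ y.1 0}) ∧ (∀ i, ∃ T : ℝ, supCkENorm (Subtype.val '' {x : (B i).domain | T ≤ t i x.1 ∧ R₀ ≤ r i x.1 ∧ ∀ j, j ≠ i → r i x.1 ≤ r j x.1}) 0 (𝓢.deviationExtend (B i) (d.chart i)) ≤ ENNReal.ofReal (1 / (10 * ‖(((d.motion i).1 : E4 ≃L[ℝ] E4) : E4 →L[ℝ] E4)‖ ^ 2))) ); ∀ (X : Type) [TopologicalSpace X] [ChartedSpace E3 X] [IsManifold (𝓡 3) ∞ X] [T2Space X] [SecondCountableTopology X] [ConnectedSpace X], InitialDataSet.IsTameChristodoulouGeneric (admissibleVacuumData X) (fun D ↦ (∃ 𝒟 : VacuumCauchyDevelopment D, 𝒟.IsMaximal) ∧ ∀ 𝒟 : VacuumCauchyDevelopment D, 𝒟.IsMaximal → HasCompleteNullInfinity 𝒟.toCauchyDevelopment ∧ ∃ (O : Set 𝒟.carrier) (d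 : FinalStateDecomposition 𝒟.toSpacetime O 4) (R₀ : ℝ), O = exteriorOf 𝒟.toCauchyDevelopment d.charted ∧ RaysStayInClosure 𝒟.toCauchyDevelopment O ∧ Hc 𝒟.toSpacetime O 4 d R₀ ∧ Hf 𝒟.toSpacetime O 4 d R₀ ∧ (∀ i j : Fin d.N, i ≠ j → ((d.motion i).1 : E4 ≃L[ℝ] E4) (E4.basisVector 0) ≠ ((d.motion j).1 : E4 ≃L[ℝ] E4) (E4.basisVector 0))) 1

/-- item stmt-FinalStateConjecture-13551 · crux · rank 4 · closed · proved by Summit.FinalStateConjecture.FinalStateConjecture.Theorems.SeamedChartsExhaust.WideAnchoring.seamedChartsExhaust (prover) · by planner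
why it might fail: Unchecked causal implication over 17 typed clauses: a causal curve may first enter closure(certifiedLate t1) on a far hole leaf (r_i>R_i+1, hole time <t1) or a tube wall at hole-early/flat-late times no SEAMED clause controls; predecessors HasLateFlatCovering/HasSeamlessNearZones died so (audit g6)
sources: arXiv:1709.06494, arXiv:1111.0400, ONeill1983, DafermosLuk2017, arXiv:2104.08222
[crux] (card K3) for EVERY admissible datum, MGHD 𝒟, O, C² decomposition d of O, radii R and R₀: O =
exteriorOf 𝒟 d.charted, HonestCore(d, R₀) and SEAMED(d, R, R₀) imply
`Summit.FinalStateConjecture.HasExhaustiveCharts d` (with these very R). Proof plan (NOTES): (α)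
every p ∈ O is chronologically below a charted point, hence causally below a point of F =
certifiedLate τ₁, by the controlled flows — ∂₀-lines in the flat region (threshold 1/10), Tᵢ =
Λᵢe₀-lines on certified tubes r ≥ R₀ (Kerr(T,T) ≤ −0.97 there, threshold 1/(10‖Λᵢ‖²)), switching
charts on the seam at rₖ = Rₖ − 3/2, anchoring below R₀, far leaves via the radiation zone; (β) the
first point of a causal curve from p in the closure of F lies on certifiedSlab τ₁: lateral points r
= Rᵢ(t*) are flat-late (clock lag + seam) hence interior, tube-wall limits are hole-charted at r =
ρ' ≥ R₀ and Tᵢ-flow to the disc, horizon-side limits are excluded by relative closedness. [deps: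
NecksCertify] [difficulty: L] -/
@[route_item "route-FinalStateConjecture-StarvedNecks", crux]
def SeamedChartsExhaust : Prop :=
  open Literature.Geometry.Lorentzian in open scoped ContDiff ENNReal in let Hc := ( fun (𝓢 : Spacetime.{0} 4) (O : Set 𝓢.carrier) (k : ℕ) (d : FinalStateDecomposition 𝓢 O k) (R₀ : ℝ) => let B := d.background; let t := fun i ↦ (B i).time; let r := fun i ↦ (B i).radius; let Ψ := d.chart; (∀ i, Kerr.IsSubextremal (d.mass i) (d.spin i) ∧ 100 * d.mass i ≤ R₀ ∧ 0 < ((d.motion i).1 : E4 ≃L[ℝ] E4) (E4.basisVector 0) 0) ∧ (∀ i (ϱ τ₂ : ℝ), R₀ ≤ ϱ → d.τ₀ < τ₂ → Ψ i '' {x | d.τ₀ < t i x.1 ∧ t i x.1 < τ₂ ∧ r i x.1 < ϱ} ⊆ 𝓢.metric.causalPast 𝓢.timeOrientation (Ψ i '' (B i).truncTimeSlab ϱ τ₂)) ∧ (∀ i (τ' : ℝ) (ϱ : ℝ → ℝ), Continuous ϱ → d.τ₀ < τ' → let A := Ψ i '' {x | τ' ≤ t i x.1 ∧ r i x.1 ≤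 ϱ (t i x.1)}; closure A ∩ O ⊆ A) ∧ (∀ y : d.flatDomain, d.τ₀ < y.1 0 → 𝓢.timeOrientation.IsFutureDirected (mfderiv 𝓘(ℝ, E4) (𝓡 4) d.flatChart y (E4.basisVector 0))) ); let Sm := ( fun (𝓢 : Spacetime.{0} 4) (O : Set 𝓢.carrier) (d : FinalStateDecomposition 𝓢 O 2) (R : Fin d.N → ℝ → ℝ) (R₀ : ℝ) => let B := d.background; let t := fun i ↦ (B i).time; let r := fun i ↦ (B i).radius; let Λ := fun i ↦ ((d.motion i).1 : E4 ≃L[ℝ] E4); let Φ := d.flatChart; let Ψ := d.chart; let ρ := d.excision; (∀ i, Monotone (R i) ∧ Continuous (R i) ∧ ∀ s, R₀ + 4 ≤ R i s ∧ R₀ ≤ ρ i s) ∧ (∀ i, Tendsto (fun τ ↦ 𝓢.truncDeviationCk (B i) (Ψ i) 2 (R i τ) τ) atTop (𝓝 0)) ∧ supCkENorm (Subtype.val '' {y : d.flatDomain | d.τ₀ ≤ y.1 0}) 0 (𝓢.deviationExtend (Minkowski.backgroundOn d.flatDomain) Φ) ≤ 10⁻¹ ∧ (∀ i, supCkENorm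 (Subtype.val '' {x : (B i).domain | (d.τ₀ ≤ t i x.1 ∨ d.τ₀ ≤ x.1 0) ∧ R₀ ≤ r i x.1 ∧ r i x.1 ≤ R i (t i x.1)}) 0 (𝓢.deviationExtend (B i) (Ψ i)) ≤ ENNReal.ofReal (1 / (10 * ‖(Λ i : E4 →L[ℝ] E4)‖ ^ 2))) ∧ (∀ i (x : (B i).domain), (d.τ₀ ≤ t i x.1 ∨ d.τ₀ ≤ x.1 0) → R₀ ≤ r i x.1 → r i x.1 ≤ R i (t i x.1) → 𝓢.timeOrientation.IsFutureDirected (mfderiv 𝓘(ℝ, E4) (𝓡 4) (Ψ i) x ((Λ i) (E4.basisVector 0)))) ∧ (∀ i (y : E4) (hy : y ∈ (B i).domain), d.τ₀ ≤ y 0 → (∀ j, ρ j (y 0) < r j y) → r i y ≤ R i (t i y) + 1 → ∃ hy' : y ∈ d.flatDomain, Ψ i ⟨y, hy⟩ = Φ ⟨y, hy'⟩) ∧ (∀ y : d.flatDomain, d.τ₀ ≤ y.1 0 → ∀ j, ρ j (y.1 0) < r j y.1) ∧ (∀ j (y : E4), d.τ₀ ≤ y 0 → r j y ≤ ρ j (y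 0) → r j y + 2 ≤ R j (t j y)) ∧ (∀ j (y : E4), d.τ₀ ≤ t j y → r j y ≤ R j (t j y) + 2 → t j y ≤ y 0) ∧ (∀ j, Ψ j '' {x | d.τ₀ < t j x.1 ∧ R j (t j x.1) + 1 < r j x.1} ⊆ d.radiationZone) ∧ (∀ τ' : ℝ, d.τ₀ < τ' → closure (Φ '' {y | τ' ≤ y.1 0}) ⊆ Φ '' {y | τ' ≤ y.1 0} ∪ ⋃ j, Ψ j '' {x | τ' ≤ x.1 0 ∧ r j x.1 = ρ j (x.1 0)}) ∧ (∀ j j' (y : E4), j ≠ j' → (d.τ₀ ≤ y 0 ∨ d.τ₀ ≤ t j y) → r j y ≤ R j (t j y) + 1 → R j' (t j' y) + 1 < r j' y) ); ∀ (X : Type) [TopologicalSpace X] [ChartedSpace E3 X] [IsManifold (𝓡 3) ∞ X] [ConnectedSpace X] (D : InitialDataSet (𝓡 3) X), D ∈ admissibleVacuumData X → ∀ 𝒟 : VacuumCauchyDevelopment D, 𝒟.IsMaximal → ∀ (O : Set 𝒟.carrier) (d : FinalStateDecomposition 𝒟.toSpacetime O 2) (R : Fin d.N → ℝ → ℝ)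 (R₀ : ℝ), O = exteriorOf 𝒟.toCauchyDevelopment d.charted → Hc 𝒟.toSpacetime O 2 d R₀ → Sm 𝒟.toSpacetime O d R R₀ → HasExhaustiveCharts d

/-- item stmt-FinalStateConjecture-17576 · crux · rank 5 · closed · proved by Summit.FinalStateConjecture.FinalStateConjecture.Theorems.FutureOrientedOfSeamed.ClockDualityRays.FutureOrientedOfSeamed_of @ 2295875915ec (prover) · by planner
why it might fail: SEAMED (5) anchors orientation only on R0' <= r <= R_i, but (ii) is asked on whole truncated slabs down to r+ and beyond R_i+1, every rho (eventually): the sign must propagate along connected slabs by C0-closeness from the structure's convergence; fails if a slab disconnects or the field goes null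
sources: arXiv:0811.0354, ONeill1983, DafermosLuk2017, arXiv:1111.0400, arXiv:2104.08222
[crux] (NEW deterministic bridge for the re-typed summit's `IsFutureOriented` conjunct; text =
Cruxes/HonestFixedRadiusSettling/RetypeKitC5.lean `FutureOrientedOfSeamed`; same binders as
SeamedChartsExhaust, conclusion replaced) for EVERY admissible datum, MGHD 𝒟, O, C² decomposition d
of O, radii R and R₀: O = exteriorOf 𝒟 d.charted, HonestCore(d, R₀) and SEAMED(d, R, R₀) imply
`Summit.FinalStateConjecture.IsFutureOriented d`. Proof plan: (i) orthochronous motions = HonestCore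
(a) literally; (iii) flat ∂₀ future-directed on every flat slab τ > τ₀ = HonestCore (d)
(kernel-checked bridge Cruxes/HonestFixedRadiusSettling/OrientKitC6.lean
`isFutureOriented_of_clauses`); (ii) for each hole and radius ρ (w.l.o.g. ρ ≥ R₀+4; truncTimeSlab is
monotone in ρ), eventually in τ the push-forward dΨᵢ(ΛᵢV) (V = Kerr.timeVector = −g♯(dt*),
g_{M,a}(V,V) = −1 − 2H ≤ −1, V bounded on r > r₊) is TIMELIKE on the truncated slab {t*ᵢ = τ, r₊ < r
≤ ρ} by the STRUCTURE's fixed-radius C² convergence; the slab is connected and timelike vectors are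
never g-orthogonal, so the time orientation of the continuous field x ↦ dΨᵢ(ΛᵢV x) is constant on
it; it is FUTURE at the anchor points R₀ ≤ r ≤ R₀+4 ≤ Rᵢ(τ) where -/
@[route_item "route-FinalStateConjecture-StarvedNecks", crux]
def FutureOrientedOfSeamed : Prop :=
  open Literature.Geometry.Lorentzian in open scoped ContDiff ENNReal in let Hc := ( fun (𝓢 : Spacetime.{0} 4) (O : Set 𝓢.carrier) (k : ℕ) (d : FinalStateDecomposition 𝓢 O k) (R₀ : ℝ) => let B := d.background; let t := fun i ↦ (B i).time; let r := fun i ↦ (B i).radius; let Ψ := d.chart; (∀ i, Kerr.IsSubextremal (d.mass i) (d.spin i) ∧ 100 * d.mass i ≤ R₀ ∧ 0 < ((d.motion i).1 : E4 ≃L[ℝ] E4) (E4.basisVector 0) 0) ∧ (∀ i (ϱ τ₂ : ℝ), R₀ ≤ ϱ → d.τ₀ < τ₂ → Ψ i '' {x | d.τ₀ < t i x.1 ∧ t i x.1 < τ₂ ∧ r i x.1 < ϱ} ⊆ 𝓢.metric.causalPast 𝓢.timeOrientation (Ψ i '' (B i).truncTimeSlab ϱ τ₂)) ∧ (∀ i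 (τ' : ℝ) (ϱ : ℝ → ℝ), Continuous ϱ → d.τ₀ < τ' → let A := Ψ i '' {x | τ' ≤ t i x.1 ∧ r i x.1 ≤ ϱ (t i x.1)}; closure A ∩ O ⊆ A) ∧ (∀ y : d.flatDomain, d.τ₀ < y.1 0 → 𝓢.timeOrientation.IsFutureDirected (mfderiv 𝓘(ℝ, E4) (𝓡 4) d.flatChart y (E4.basisVector 0))) ); let Sm := ( fun (𝓢 : Spacetime.{0} 4) (O : Set 𝓢.carrier) (d : FinalStateDecomposition 𝓢 O 2) (R : Fin d.N → ℝ → ℝ) (R₀ : ℝ) => let B := d.background; let t := fun i ↦ (B i).time; let r := fun i ↦ (B i).radius; let Λ := fun i ↦ ((d.motion i).1 : E4 ≃L[ℝ] E4); let Φ := d.flatChart; let Ψ := d.chart; let ρ := d.excision; (∀ i, Monotone (R i) ∧ Continuous (R i) ∧ ∀ s, R₀ + 4 ≤ R i s ∧ R₀ ≤ ρ i s) ∧ (∀ i, Tendsto (fun τ ↦ 𝓢.truncDeviationCk (B i) (Ψ i) 2 (R i τ) τ) atTop (𝓝 0)) ∧ supCkENorm (Subtype.val '' {y : d.flatDomain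 | d.τ₀ ≤ y.1 0}) 0 (𝓢.deviationExtend (Minkowski.backgroundOn d.flatDomain) Φ) ≤ 10⁻¹ ∧ (∀ i, supCkENorm (Subtype.val '' {x : (B i).domain | (d.τ₀ ≤ t i x.1 ∨ d.τ₀ ≤ x.1 0) ∧ R₀ ≤ r i x.1 ∧ r i x.1 ≤ R i (t i x.1)}) 0 (𝓢.deviationExtend (B i) (Ψ i)) ≤ ENNReal.ofReal (1 / (10 * ‖(Λ i : E4 →L[ℝ] E4)‖ ^ 2))) ∧ (∀ i (x : (B i).domain), (d.τ₀ ≤ t i x.1 ∨ d.τ₀ ≤ x.1 0) → R₀ ≤ r i x.1 → r i x.1 ≤ R i (t i x.1) → 𝓢.timeOrientation.IsFutureDirected (mfderiv 𝓘(ℝ, E4) (𝓡 4) (Ψ i) x ((Λ i) (E4.basisVector 0)))) ∧ (∀ i (y : E4) (hy : y ∈ (B i).domain), d.τ₀ ≤ y 0 → (∀ j, ρ j (y 0) < r j y) → r i y ≤ R i (t i y) + 1 → ∃ hy' : y ∈ d.flatDomain, Ψ i ⟨y, hy⟩ = Φ ⟨y, hy'⟩) ∧ (∀ y : d.flatDomain,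 d.τ₀ ≤ y.1 0 → ∀ j, ρ j (y.1 0) < r j y.1) ∧ (∀ j (y : E4), d.τ₀ ≤ y 0 → r j y ≤ ρ j (y 0) → r j y + 2 ≤ R j (t j y)) ∧ (∀ j (y : E4), d.τ₀ ≤ t j y → r j y ≤ R j (t j y) + 2 → t j y ≤ y 0) ∧ (∀ j, Ψ j '' {x | d.τ₀ < t j x.1 ∧ R j (t j x.1) + 1 < r j x.1} ⊆ d.radiationZone) ∧ (∀ τ' : ℝ, d.τ₀ < τ' → closure (Φ '' {y | τ' ≤ y.1 0}) ⊆ Φ '' {y | τ' ≤ y.1 0} ∪ ⋃ j, Ψ j '' {x | τ' ≤ x.1 0 ∧ r j x.1 = ρ j (x.1 0)}) ∧ (∀ j j' (y : E4), j ≠ j' → (d.τ₀ ≤ y 0 ∨ d.τ₀ ≤ t j y) → r j y ≤ R j (t j y) + 1 → R j' (t j' y) + 1 < r j' y) ); ∀ (X : Type) [TopologicalSpace X] [ChartedSpace E3 X] [IsManifold (𝓡 3) ∞ X] [ConnectedSpace X] (D : InitialDataSet (𝓡 3) X), D ∈ admissibleVacuumData X → ∀ 𝒟 : VacuumCauchyDevelopment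 D, 𝒟.IsMaximal → ∀ (O : Set 𝒟.carrier) (d : FinalStateDecomposition 𝒟.toSpacetime O 2) (R : Fin d.N → ℝ → ℝ) (R₀ : ℝ), O = exteriorOf 𝒟.toCauchyDevelopment d.charted → Hc 𝒟.toSpacetime O 2 d R₀ → Sm 𝒟.toSpacetime O d R R₀ → IsFutureOriented d

/-- item stmt-FinalStateConjecture-18060 · crux · rank 6 · open · by planner
why it might fail: Liouville/FJM rigidity degrades on thin shells of radius rho -> infinity (local Lorentz fits drift by delta*rho): the one-atlas blend needs length >~ rho and log-room 4rho_a/rho -> infinity against an unbounded relative rotation (AUDIT-c4 (A)); a too-weak G4/G5 clause makes it misstated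
sources: FrieseckeJamesMuller2002, ONeill1983, DafermosLuk2017, arXiv:2104.08222
[crux] (= the lead census' PosSoft composed with what has LANDED; gauge geometry, no PDE, provable
now, XL in Lean) gap certificates at every hole re-gauge into the v5 skeleton's NeckCertificate
(K1–K12: analysis walls ρₐ ≫ drift, certified radii Rc, re-gauged charts Ψₐ = Ψᵢ inside R₁+1, ONE
ATLAS with the input's undrifted flat chart beyond 4ρₐ, C² certification out to Rc, C⁰ honesty,
future lines, image-disjoint tubes, relative closedness, causal covering), after which
`…Theorems.NecksCertifyRRelations.necksCertifyR_of_neckLedgerAnalysisPos` (p131681, std axioms;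
built on the landed seam N2 p94437 + 16 layers, chart surgery p107332, cone separation p106992, N =
0 certificate p116183/p116546) gives NecksCertifyR — kernel-checked reduction
`gapDecaySuffices_of_posSoft` in the planner's Sketch.lean (evidence). Toolkit (AUDIT-c4 §2–3): (s1)
Lorentzian quantitative transition-map rigidity T = Φ⁻¹∘Ψg on the overlap shell {ρᵢ < rᵢ ≤ ρᵢ+2},
D²T = DT·Γ(T*g) − Γ(g)∘T(DT,DT), a-priori ‖DT‖ from the timelike legs (extends the landed Riemannian
ADMTransitionRigidity.norm_snd_le_of_law / ADMTransitionRotation.exists_rotation /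
LocalIsometryJetRigidity); (s2) belt-trick unwinding in SO(3)/S³ of -/
@[route_item "route-FinalStateConjecture-StarvedNecks", crux]
def GapDecaySuffices : Prop :=
  NeckGapDecay → NecksCertifyR

/-- item stmt-FinalStateConjecture-13549 · support · rank 2 · open · by planner
why it might fail: Influx through r=R0 and neck-born nonlinear tails (Luk-Oh) must be o(1) in SCALE-INVARIANT C^3 norms, yet G certifies unweighted norms at fixed radii only; external-region Kerr stability (Caciotta-Nicolo; Shen Thm 1.6-1.7) lives outside I+(K) with no inner characteristic data: shell IBVP unprinted
sources: arXiv:2303.12758, doi:10.1007/s00023-010-0032-9, arXiv:2404.02220, KlainermanNicolo2003, arXiv:2211.15230, arXiv:0904.0620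
[crux] (card K1+K2 with the K3 input, composite) for EVERY admissible datum, every MGHD 𝒟, every C⁴
final-state decomposition d of O with O = exteriorOf 𝒟 d.charted, HonestCore(d, R₀) and HonestFar(d,
R₀): there are a C² decomposition d₂ of the same O with O = exteriorOf 𝒟 d₂.charted and
HonestCore(d₂, R₀') (sub-extremal holes, R₀' ≥ 100Mᵢ, orthochronous boosts, anchoring at every
radius ≥ R₀', relatively closed late tubes of any continuous radius profile, future-oriented flat
chart), radii Rᵢ (monotone, continuous, ≥ R₀'+4) and SEAMED(d₂, R, R₀'): flat tubes ≥ R₀'; C²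
certification of each hole chart out to Rᵢ(τ) (clause (i) of HasExhaustiveCharts); C⁰ thresholds
1/10 (flat, from τ₀) and 1/(10‖Λᵢ‖²) (hole tubes R₀' ≤ r ≤ Rᵢ, flat-late or hole-late) and
future-oriented hole time-lines there; ONE ATLAS (outside the flat tubes at flat-late times, within
Rᵢ+1 of hole i, chartᵢ = flatChart); flat-late domain = tube complement; flat tubes deep (margin 2)
inside certified tubes; hole clocks ≤ flat clock on certified tubes (+2); far hole leaves (r > Rᵢ+1)
inside the radiation zone; closures of flat-late regions = flat points ∪ hole-charted tube walls;
certified tubes (+1) of different hol -/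
@[route_item "route-FinalStateConjecture-StarvedNecks", crux]
def NecksCertify : Prop :=
  open Literature.Geometry.Lorentzian in open scoped ContDiff ENNReal in let Hc := ( fun (𝓢 : Spacetime.{0} 4) (O : Set 𝓢.carrier) (k : ℕ) (d : FinalStateDecomposition 𝓢 O k) (R₀ : ℝ) => let B := d.background; let t := fun i ↦ (B i).time; let r := fun i ↦ (B i).radius; let Ψ := d.chart; (∀ i, Kerr.IsSubextremal (d.mass i) (d.spin i) ∧ 100 * d.mass i ≤ R₀ ∧ 0 < ((d.motion i).1 : E4 ≃L[ℝ] E4) (E4.basisVector 0) 0) ∧ (∀ i (ϱ τ₂ : ℝ), R₀ ≤ ϱ → d.τ₀ < τ₂ → Ψ i '' {x | d.τ₀ < t i x.1 ∧ t i x.1 < τ₂ ∧ r i x.1 < ϱ} ⊆ 𝓢.metric.causalPast 𝓢.timeOrientation (Ψ i '' (B i).truncTimeSlab ϱ τ₂)) ∧ (∀ i (τ' : ℝ) (ϱ : ℝ → ℝ), Continuous ϱ → d.τ₀ < τ' → let A := Ψ i '' {x | τ' ≤ t i x.1 ∧ r i x.1 ≤ ϱ (t i x.1)}; closure A ∩ O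 ⊆ A) ∧ (∀ y : d.flatDomain, d.τ₀ < y.1 0 → 𝓢.timeOrientation.IsFutureDirected (mfderiv 𝓘(ℝ, E4) (𝓡 4) d.flatChart y (E4.basisVector 0))) ); let Hf := ( fun (𝓢 : Spacetime.{0} 4) (O : Set 𝓢.carrier) (k : ℕ) (d : FinalStateDecomposition 𝓢 O k) (R₀ : ℝ) => let B := d.background; let t := fun i ↦ (B i).time; let r := fun i ↦ (B i).radius; let Φ := d.flatChart; (∀ τ₂ : ℝ, d.τ₀ < τ₂ → Φ '' {y | d.τ₀ < y.1 0 ∧ y.1 0 < τ₂} ⊆ 𝓢.metric.causalPast 𝓢.timeOrientation (Φ '' (Minkowski.backgroundOn d.flatDomain).timeSlab τ₂)) ∧ (∀ τ' : ℝ, d.τ₀ < τ' → closure (Φ '' {y | τ' ≤ y.1 0 ∧ ∀ i, d.excision i (y.1 0) + 1 ≤ r i y.1}) ⊆ Φ '' {y | τ' ≤ y.1 0}) ∧ (∀ i, ∃ T : ℝ, supCkENorm (Subtype.val '' {x : (B i).domain | T ≤ t i x.1 ∧ R₀ ≤ r i x.1 ∧ ∀ j, j ≠ i → r i x.1 ≤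 r j x.1}) 0 (𝓢.deviationExtend (B i) (d.chart i)) ≤ ENNReal.ofReal (1 / (10 * ‖(((d.motion i).1 : E4 ≃L[ℝ] E4) : E4 →L[ℝ] E4)‖ ^ 2))) ); let Sm := ( fun (𝓢 : Spacetime.{0} 4) (O : Set 𝓢.carrier) (d : FinalStateDecomposition 𝓢 O 2) (R : Fin d.N → ℝ → ℝ) (R₀ : ℝ) => let B := d.background; let t := fun i ↦ (B i).time; let r := fun i ↦ (B i).radius; let Λ := fun i ↦ ((d.motion i).1 : E4 ≃L[ℝ] E4); let Φ := d.flatChart; let Ψ := d.chart; let ρ := d.excision; (∀ i, Monotone (R i) ∧ Continuous (R i) ∧ ∀ s, R₀ + 4 ≤ R i s ∧ R₀ ≤ ρ i s) ∧ (∀ i, Tendsto (fun τ ↦ 𝓢.truncDeviationCk (B i) (Ψ i) 2 (R i τ) τ) atTop (𝓝 0)) ∧ supCkENorm (Subtype.val '' {y : d.flatDomain | d.τ₀ ≤ y.1 0}) 0 (𝓢.deviationExtend (Minkowski.backgroundOn d.flatDomain) Φ) ≤ 10⁻¹ ∧ (∀ i, supCkENorm (Subtype.val '' {x : (B i).domain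 | (d.τ₀ ≤ t i x.1 ∨ d.τ₀ ≤ x.1 0) ∧ R₀ ≤ r i x.1 ∧ r i x.1 ≤ R i (t i x.1)}) 0 (𝓢.deviationExtend (B i) (Ψ i)) ≤ ENNReal.ofReal (1 / (10 * ‖(Λ i : E4 →L[ℝ] E4)‖ ^ 2))) ∧ (∀ i (x : (B i).domain), (d.τ₀ ≤ t i x.1 ∨ d.τ₀ ≤ x.1 0) → R₀ ≤ r i x.1 → r i x.1 ≤ R i (t i x.1) → 𝓢.timeOrientation.IsFutureDirected (mfderiv 𝓘(ℝ, E4) (𝓡 4) (Ψ i) x ((Λ i) (E4.basisVector 0)))) ∧ (∀ i (y : E4) (hy : y ∈ (B i).domain), d.τ₀ ≤ y 0 → (∀ j, ρ j (y 0) < r j y) → r i y ≤ R i (t i y) + 1 → ∃ hy' : y ∈ d.flatDomain, Ψ i ⟨y, hy⟩ = Φ ⟨y, hy'⟩) ∧ (∀ y : d.flatDomain, d.τ₀ ≤ y.1 0 → ∀ j, ρ j (y.1 0) < r j y.1) ∧ (∀ j (y : E4), d.τ₀ ≤ y 0 → r j y ≤ ρ j (y 0) → r j y + 2 ≤ R j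 (t j y)) ∧ (∀ j (y : E4), d.τ₀ ≤ t j y → r j y ≤ R j (t j y) + 2 → t j y ≤ y 0) ∧ (∀ j, Ψ j '' {x | d.τ₀ < t j x.1 ∧ R j (t j x.1) + 1 < r j x.1} ⊆ d.radiationZone) ∧ (∀ τ' : ℝ, d.τ₀ < τ' → closure (Φ '' {y | τ' ≤ y.1 0}) ⊆ Φ '' {y | τ' ≤ y.1 0} ∪ ⋃ j, Ψ j '' {x | τ' ≤ x.1 0 ∧ r j x.1 = ρ j (x.1 0)}) ∧ (∀ j j' (y : E4), j ≠ j' → (d.τ₀ ≤ y 0 ∨ d.τ₀ ≤ t j y) → r j y ≤ R j (t j y) + 1 → R j' (t j' y) + 1 < r j' y) ); ∀ (X : Type) [TopologicalSpace X] [ChartedSpace E3 X] [IsManifold (𝓡 3) ∞ X] [ConnectedSpace X] (D : InitialDataSet (𝓡 3) X), D ∈ admissibleVacuumData X → ∀ 𝒟 : VacuumCauchyDevelopment D, 𝒟.IsMaximal → ∀ (O : Set 𝒟.carrier) (d : FinalStateDecomposition 𝒟.toSpacetime O 4) (R₀ : ℝ), O = exteriorOf 𝒟.toCauchyDevelopment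 d.charted → Hc 𝒟.toSpacetime O 4 d R₀ → Hf 𝒟.toSpacetime O 4 d R₀ → ∃ (d₂ : FinalStateDecomposition 𝒟.toSpacetime O 2) (R : Fin d₂.N → ℝ → ℝ) (R₀' : ℝ), O = exteriorOf 𝒟.toCauchyDevelopment d₂.charted ∧ Hc 𝒟.toSpacetime O 2 d₂ R₀' ∧ Sm 𝒟.toSpacetime O d₂ R R₀'

/-- item stmt-FinalStateConjecture-13550 · support · rank 3 · open · by planner
why it might fail: Most of the conjecture at once, generically: MGHD with complete scri+ (weak censorship), finitely many holes, fixed-radius no-hair to ONE sub-extremal boosted Kerr each, flat radiation zone, honest C^4 charts; generic naked singularities, cascades of small holes, wandering velocities, extremal ends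
sources: DafermosLuk2017, GiorgiKlainermanSzeftel2022, arXiv:2104.08222, Christodoulou2008, arXiv:0811.0354, arXiv:2402.10190
[crux] (generic import; the only item carrying Christodoulou genericity, which is not closed under
∧) for every admissible 3-manifold X, Christodoulou-generic in admissibleVacuumData X is: D has an
MGHD, and every MGHD 𝒟 has complete future null infinity (sojourn form) and admits O, a C⁴
`FinalStateDecomposition 𝒟.toSpacetime O 4` d and R₀ with O = exteriorOf 𝒟 d.charted and
HonestCore(d, R₀) ∧ HonestFar(d, R₀): every hole sub-extremal, R₀ ≥ 100 Mᵢ and orthochronous boosts;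
hole-late points of {r < ϱ} lie in J⁻ of every later disc {t*ᵢ = τ₂, r ≤ ϱ} (ϱ ≥ R₀); every late
tube portion {τ' ≤ t*, r ≤ ϱ(t*)} (any continuous radius profile ϱ) is relatively closed in O; the
flat chart is future-oriented (Core); flat-late points lie in J⁻ of every later flat slab; closures
of far flat slabs (≥ 1 outside the tubes) are flat points; eventually each hole chart is C⁰-close
(1/(10‖Λᵢ‖²)) to its boosted Kerr on its own Voronoi cell beyond R₀ — no hidden strong field (Far).
Fixed-radius near-zone convergence and the flat radiation zone are the structure's own clauses;
NOTHING is asked on the necks. [difficulty: open-problem] -/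
@[route_item "route-FinalStateConjecture-StarvedNecks"]
def HonestFixedRadiusSettling : Prop :=
  open Literature.Geometry.Lorentzian in open scoped ContDiff ENNReal in let Hc := ( fun (𝓢 : Spacetime.{0} 4) (O : Set 𝓢.carrier) (k : ℕ) (d : FinalStateDecomposition 𝓢 O k) (R₀ : ℝ) => let B := d.background; let t := fun i ↦ (B i).time; let r := fun i ↦ (B i).radius; let Ψ := d.chart; (∀ i, Kerr.IsSubextremal (d.mass i) (d.spin i) ∧ 100 * d.mass i ≤ R₀ ∧ 0 < ((d.motion i).1 : E4 ≃L[ℝ] E4) (E4.basisVector 0) 0) ∧ (∀ i (ϱ τ₂ : ℝ), R₀ ≤ ϱ → d.τ₀ < τ₂ → Ψ i '' {x | d.τ₀ < t i x.1 ∧ t i x.1 < τ₂ ∧ r i x.1 < ϱ} ⊆ 𝓢.metric.causalPast 𝓢.timeOrientation (Ψ i '' (B i).truncTimeSlab ϱ τ₂)) ∧ (∀ i (τ' : ℝ) (ϱ : ℝ → ℝ), Continuous ϱ → d.τ₀ < τ' → let A := Ψ i '' {x | τ' ≤ t i x.1 ∧ r i x.1 ≤ ϱ (t i x.1)}; closure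 A ∩ O ⊆ A) ∧ (∀ y : d.flatDomain, d.τ₀ < y.1 0 → 𝓢.timeOrientation.IsFutureDirected (mfderiv 𝓘(ℝ, E4) (𝓡 4) d.flatChart y (E4.basisVector 0))) ); let Hf := ( fun (𝓢 : Spacetime.{0} 4) (O : Set 𝓢.carrier) (k : ℕ) (d : FinalStateDecomposition 𝓢 O k) (R₀ : ℝ) => let B := d.background; let t := fun i ↦ (B i).time; let r := fun i ↦ (B i).radius; let Φ := d.flatChart; (∀ τ₂ : ℝ, d.τ₀ < τ₂ → Φ '' {y | d.τ₀ < y.1 0 ∧ y.1 0 < τ₂} ⊆ 𝓢.metric.causalPast 𝓢.timeOrientation (Φ '' (Minkowski.backgroundOn d.flatDomain).timeSlab τ₂)) ∧ (∀ τ' : ℝ, d.τ₀ < τ' → closure (Φ '' {y | τ' ≤ y.1 0 ∧ ∀ i, d.excision i (y.1 0) + 1 ≤ r i y.1}) ⊆ Φ '' {y | τ' ≤ y.1 0}) ∧ (∀ i, ∃ T : ℝ, supCkENorm (Subtype.val '' {x : (B i).domain | T ≤ t i x.1 ∧ R₀ ≤ r i x.1 ∧ ∀ j, j ≠ i → r i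 x.1 ≤ r j x.1}) 0 (𝓢.deviationExtend (B i) (d.chart i)) ≤ ENNReal.ofReal (1 / (10 * ‖(((d.motion i).1 : E4 ≃L[ℝ] E4) : E4 →L[ℝ] E4)‖ ^ 2))) ); ∀ (X : Type) [TopologicalSpace X] [ChartedSpace E3 X] [IsManifold (𝓡 3) ∞ X] [T2Space X] [SecondCountableTopology X] [ConnectedSpace X], InitialDataSet.IsChristodoulouGeneric (admissibleVacuumData X) (fun D ↦ (∃ 𝒟 : VacuumCauchyDevelopment D, 𝒟.IsMaximal) ∧ ∀ 𝒟 : VacuumCauchyDevelopment D, 𝒟.IsMaximal → HasCompleteNullInfinity 𝒟.toCauchyDevelopment ∧ ∃ (O : Set 𝒟.carrier) (d : FinalStateDecomposition 𝒟.toSpacetime O 4) (R₀ : ℝ), O = exteriorOf 𝒟.toCauchyDevelopment d.charted ∧ Hc 𝒟.toSpacetime O 4 d R₀ ∧ Hf 𝒟.toSpacetime O 4 d R₀) 1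

/-- item stmt-FinalStateConjecture-13552 · support · rank 9 · closed · proved by Summit.FinalStateConjecture.FinalStateConjecture.Theorems.DiagonalRadii.diagonalRadii_proof @ 7ff4def0651d (prover) · by planner
sources: arXiv:2104.08222, Bartnik1986
[support] (clause (i) is free; only the RATE is content) if a : ℝ → ℝ → ℝ≥0∞ is monotone in the
radius and a ρ τ → 0 as τ → ∞ for every fixed ρ, then some monotone continuous Rg → ∞ has a (Rg τ) τ
→ 0 (applies to truncDeviationCk, monotone in R by truncDeviationCk_mono). [difficulty:
provable-now] -/
@[route_item "route-FinalStateConjecture-StarvedNecks"]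
def DiagonalRadii : Prop :=
  open Literature.Geometry.Lorentzian in open scoped ContDiff ENNReal in ∀ a : ℝ → ℝ → ℝ≥0∞, (∀ τ, Monotone (fun ρ ↦ a ρ τ)) → (∀ ρ, Tendsto (fun τ ↦ a ρ τ) atTop (𝓝 0)) → ∃ Rg : ℝ → ℝ, Monotone Rg ∧ Continuous Rg ∧ Tendsto Rg atTop atTop ∧ Tendsto (fun τ ↦ a (Rg τ) τ) atTop (𝓝 0)

/-- item stmt-FinalStateConjecture-13553 · support · rank 9 · closed · proved by Summit.FinalStateConjecture.FinalStateConjecture.Theorems.kerrSchildTailDecay_proof @ 13fbef908065 (prover) · by planner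
sources: KerrSchild1965, arXiv:0706.0622, arXiv:2104.08222
[support] (why any ρ' → ∞ works for the flat chart, and the size of the model correction on a shell)
for sub-extremal (M, a) there is C with the C² sup norm of Kerr.bilin M a − Minkowski.bilin over
{Kerr.radius a x ≥ ρ} at most C/ρ for all ρ ≥ 4M (H = 2Mr³/(r⁴+a²z²) ≤ 2M/r, Dᵐℓ = O(r⁻ᵐ)).
[difficulty: provable-now] -/
@[route_item "route-FinalStateConjecture-StarvedNecks"]
def KerrSchildTailDecay : Prop :=
  open Literature.Geometry.Lorentzian in open scoped ContDiff ENNReal in ∀ M a : ℝ, Kerr.IsSubextremal M a → ∃ C : ℝ, ∀ ρ : ℝ, 4 * M ≤ ρ → supCkENorm {x : E4 | ρ ≤ Kerr.radius a x} 2 (fun x ↦ Kerr.bilin M a x - Minkowski.bilin) ≤ ENNReal.ofReal (C / ρ)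

/-- item stmt-FinalStateConjecture-13554 · assembly · rank 1 · closed · proved by Summit.FinalStateConjecture.FinalStateConjecture.Theorems.StarvedNecks.assembly_proof @ f648441f8c8f (prover) · by planner
sources: DafermosLuk2017, Christodoulou1999
[assembly] HonestFixedRadiusSettling → NecksCertify → SeamedChartsExhaust → the sub-problem
statement. -/
@[route_item "route-FinalStateConjecture-StarvedNecks"]
def Assembly : Prop :=
  HonestFixedRadiusSettling → NecksCertify → SeamedChartsExhaust → FinalStateConjecture

/-! D-0027 §2.1 — DECIDING THEOREM (planner-authored via `route open/edit --closes-file`; by planner-promote-FinalStateConjecture-StarvedNe-af37d317-0 2026-08-17T00:04:49Z):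
its hypotheses are this route's items and its conclusion the sub-problem Statement (glue_lint), and it elaborates with this file. -/

@[closes "route-FinalStateConjecture-StarvedNecks"] theorem closes (h₁ : HonestFixedRadiusSettlingT) (h₂ : NeckGapDecay) (h₃ : GapDecaySuffices) (h₄ : SeamedChartsExhaust)
    (h₅ : FutureOrientedOfSeamed) : _root_.FinalStateConjecture := by
  intro X _ _ _ _ _ _
  -- tame Christodoulou genericity is antitone in the exceptional set: a pointwise implication on the admissible class transfers it
  have mono : ∀ (P Q : Literature.Geometry.Lorentzian.InitialDataSet (𝓡 3) X → Prop),
      (∀ D ∈ Literature.Geometry.Lorentzian.admissibleVacuumData X, P D → Q D) →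
      Literature.Geometry.Lorentzian.InitialDataSet.IsTameChristodoulouGeneric
        (Literature.Geometry.Lorentzian.admissibleVacuumData X) P 1 →
      Literature.Geometry.Lorentzian.InitialDataSet.IsTameChristodoulouGeneric
        (Literature.Geometry.Lorentzian.admissibleVacuumData X) Q 1 := by
    intro P Q hPQ hP d hd
    obtain ⟨e, F, hF, himm, h0, hinj, hmem, hE⟩ := hP d ⟨hd.1, fun h ↦ hd.2 (hPQ d hd.1 h)⟩
    exact ⟨e, F, hF, himm, h0, hinj, hmem, fun c hc hc' ↦ hE c hc ⟨hc'.1, fun h ↦ hc'.2 (hPQ _ hc'.1 h)⟩⟩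
  -- S (NecksCertifyR) from its physics (NeckGapDecay) and its gauge (GapDecaySuffices := NeckGapDecay → NecksCertifyR)
  have hS : NecksCertifyR := h₃ h₂
  refine mono _ _ ?_ (h₁ X)
  rintro D hD ⟨hex, hall⟩
  refine ⟨hex, fun 𝒟 h𝒟 ↦ ?_⟩
  -- G_T: complete scri, the honest C⁴ decomposition of O = exteriorOf with the rays clause and distinct velocities
  obtain ⟨hscri, O, d, R₀, hO, hrays, hcore, hfar, hdv⟩ := hall 𝒟 h𝒟
  refine ⟨hscri, ?_⟩
  -- S_R: re-seam into a C² HonestCore ∧ SEAMED decomposition of the same O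
  obtain ⟨d₂, R, R₀', hO₂, hcore₂, hseam⟩ := hS X D hD 𝒟 h𝒟 O d R₀ hO hcore hfar hdv
  -- E: exhaustive charts (honest radii); F: future orientation; sub-extremality = HonestCore (a).1; rays = G_T's, same O
  exact ⟨O, d₂, fun i ↦ (hcore₂.1 i).1, hO₂, hrays, h₄ X D hD 𝒟 h𝒟 O d₂ R R₀' hO₂ hcore₂ hseam,
    h₅ X D hD 𝒟 h𝒟 O d₂ R R₀' hO₂ hcore₂ hseam⟩

end Summit.FinalStateConjecture.FinalStateConjecture.Theses.StarvedNecks
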